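import Literature.Analysis.UnboundedOperators.UnitaryGroupGenerator
import Mathlib.Analysis.Complex.RealDeriv
import HarnessLib

/-!
# Positivity of the energy from a bounded analytic extension to the upper half-plane

Topic `Literature/Analysis/UnboundedOperators`, proofs layer over `UnitaryRep.lean` (Stone generator,
`HasPositiveEnergy`) — the CONVERSE companion of `PositiveEnergyAnalyticContinuation.lean`. Let
`T(s) = e^{isP} = e^{sA}` (`A = iP` the generator) be a strongly continuous one-parameter unitary
group on a complex Hilbert space. Classically (spectral theorem): `P ≥ 0` iff `s ↦ T(s)` extends to a
bounded (by `1`) weakly continuous family on the closed upper half-plane, holomorphic inside. This is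
how positivity of the translation generator is READ OFF in the half-sided modular inclusion theorem
(R. Longo, *Lectures on Conformal Nets* I, proof of Thm. 2.4.1, p. 41: "`U` is a continuous
one-parameter group of unitaries, which allows a strongly continuous extension in the upper half
plane `ℑz ≥ 0`, analytic in `ℑz > 0` and norm bounded by `1`. Consequently `U(s) = e^{isP}` for some
positive selfadjoint operator `P`"). Mathlib has no spectral theorem for unbounded self-adjoint
operators; here is an elementary proof, which moreover only needs the extension LOCALLY, near `0`:

* `hasPositiveEnergy_of_upperHalfPlane_extension` — if for some `r > 0` there are contractions
  `U(w)`, `0 ≤ im w`, `|w| < r`, with `U(0) = 1`, all matrix elements `⟪x, U(w) y⟫` continuous on this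
  half-disc and holomorphic on its interior, and `U(w + h) = U(w) T(h)` for real `h > 0` (interior
  `w`), then `T.HasPositiveEnergy`.

Proof. For `x ∈ D(A)` put `φ(w) = ⟪x, U(w) x⟫`, `ψ(w) = ⟪x, U(w) A x⟫`. At an interior point `w` the
complex derivative of `φ` can be computed along real increments, where `U(w + h) = U(w)T(h)` and
`h⁻¹(T(h)x − x) → Ax` give `φ' = ψ`. By the fundamental theorem of calculus along the segment
`[0, iY]`, `φ(iY) − ‖x‖² = i ∫₀^Y ψ(iy) dy`; the left side has real part `≤ 0` (`‖U(iY)‖ ≤ 1`), while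
`re (i ψ(iy)) → re (i⟪x, Ax⟫) = −im ⟪x, Ax⟫` as `y ↓ 0`. Hence `im ⟪x, Ax⟫ ≥ 0`, i.e.
`⟪x, P x⟫ = re ⟪x, −iA x⟫ ≥ 0`; symmetry of `P` is `hamiltonian_isSymmetric`.

References: R. Longo, *Lectures on Conformal Nets* I (2008), proof of Thm. 2.4.1
[Longo2008LecturesConformalNets]; M. Reed, B. Simon, *Methods of Modern Mathematical Physics II*
(1975), §X.8 (the spectral-theorem route). The statement is folklore.
-/

noncomputable section

open Filter Topology MeasureTheory intervalIntegral Complex Set Metric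
open scoped InnerProductSpace

namespace Literature.Analysis.UnboundedOperators

namespace UnitaryRep

variable {H : Type*} [NormedAddCommGroup H] [InnerProductSpace ℂ H] [CompleteSpace H]

/-- The open half-disc `{0 < im w, |w| < r}` is open. [folklore] -/
theorem isOpen_halfDisc (r : ℝ) : IsOpen {w : ℂ | 0 < w.im ∧ ‖w‖ < r} :=
  (isOpen_lt continuous_const continuous_im).inter (isOpen_lt continuous_norm continuous_const)

/-- `i y`, `0 ≤ y < r`, lies in the closed half-disc. [folklore] -/
theorem I_mul_mem_closedHalfDisc {r y : ℝ} (hy : 0 ≤ y) (hyr : y < r) :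
    I * (y : ℂ) ∈ {w : ℂ | 0 ≤ w.im ∧ ‖w‖ < r} := by
  refine ⟨by simp [hy], ?_⟩
  rw [norm_mul, norm_I, one_mul, Complex.norm_real, Real.norm_eq_abs, abs_of_nonneg hy]
  exact hyr

/-- `i y`, `0 < y < r`, lies in the open half-disc. [folklore] -/
theorem I_mul_mem_halfDisc {r y : ℝ} (hy : 0 < y) (hyr : y < r) :
    I * (y : ℂ) ∈ {w : ℂ | 0 < w.im ∧ ‖w‖ < r} := by
  refine ⟨by simp [hy], ?_⟩
  rw [norm_mul, norm_I, one_mul, Complex.norm_real, Real.norm_eq_abs, abs_of_pos hy]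
  exact hyr

/-- **The complex derivative of a matrix element `⟪x, U(w) x⟫` along the extension is
`⟪x, U(w) A x⟫` for `x ∈ D(A)`**, computed along real increments through `U(w + h) = U(w) T(h)`.
[cite: Longo2008LecturesConformalNets, Thm. 2.4.1 (proof)] -/
theorem hasDerivAt_inner_extension (T : OneParameterUnitaryGroup H) {r : ℝ}
    (U : ℂ → H →L[ℂ] H)
    (hdiff : ∀ x y : H, DifferentiableOn ℂ (fun w => ⟪x, U w y⟫_ℂ) {w : ℂ | 0 < w.im ∧ ‖w‖ < r})
    (hmul : ∀ w : ℂ, 0 < w.im → ‖w‖ < r → ∀ h : ℝ, 0 < h → ‖w + h‖ < r →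
      U (w + h) = U w * T.appReal h)
    (x : (OneParameterGroup.generator T.toStrongContRepresentation).domain) (y : H)
    {w : ℂ} (hw : 0 < w.im) (hwr : ‖w‖ < r) :
    HasDerivAt (fun w => ⟪y, U w x⟫_ℂ)
      ⟪y, U w (OneParameterGroup.generator T.toStrongContRepresentation x)⟫_ℂ w := by
  set v : H := (OneParameterGroup.generator T.toStrongContRepresentation x : H) with hv
  -- the generator limit, in the `appReal` form
  have hTt : ∀ t : ℝ, 0 < t →
      (OneParameterGroup.toC0Semigroup T.toStrongContRepresentation).app t.toNNReal = T.appReal t :=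
    fun t ht => by
      rw [OneParameterGroup.toC0Semigroup_app, Real.coe_toNNReal _ ht.le, app_toStrongContRepresentation]
  have hx : Tendsto (fun t : ℝ => ((t⁻¹ : ℝ) : ℂ) • (T.appReal t (x : H) - x)) (𝓝[>] 0) (𝓝 v) := by
    refine (C0Semigroup.tendsto_generator
      (OneParameterGroup.toC0Semigroup T.toStrongContRepresentation) x).congr' ?_
    filter_upwards [self_mem_nhdsWithin] with t (ht : 0 < t)
    rw [hTt t ht]
    rfl
  -- the complex derivative exists
  set φ : ℂ → ℂ := fun w => ⟪y, U w x⟫_ℂ with hφ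
  have hφd : HasDerivAt φ (deriv φ w) w :=
    ((hdiff y x).differentiableAt ((isOpen_halfDisc r).mem_nhds ⟨hw, hwr⟩)).hasDerivAt
  -- compute it along real increments `h ↓ 0`
  have hmap : Tendsto (fun h : ℝ => w + h) (𝓝[>] 0) (𝓝[≠] w) := by
    refine tendsto_nhdsWithin_of_tendsto_nhds_of_eventually_within _ ?_ ?_
    · have hc : Continuous fun h : ℝ => w + h := by fun_prop
      have h0 : Tendsto (fun h : ℝ => w + h) (𝓝 0) (𝓝 w) := by simpa using hc.tendsto 0
      exact h0.mono_left nhdsWithin_le_nhds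
    · filter_upwards [self_mem_nhdsWithin] with h (hh : 0 < h)
      simp [hh.ne']
  have h1 : Tendsto (fun h : ℝ => slope φ w (w + h)) (𝓝[>] 0) (𝓝 (deriv φ w)) :=
    (hasDerivAt_iff_tendsto_slope.1 hφd).comp hmap
  have hev : ∀ᶠ h : ℝ in 𝓝[>] 0, ‖w + h‖ < r := by
    have hc : Continuous fun h : ℝ => ‖w + (h : ℂ)‖ := by fun_prop
    have : ‖w + ((0 : ℝ) : ℂ)‖ < r := by simpa using hwr
    exact nhdsWithin_le_nhds (hc.continuousAt.eventually_lt continuousAt_const this)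
  have h2 : Tendsto (fun h : ℝ => slope φ w (w + h)) (𝓝[>] 0) (𝓝 ⟪y, U w v⟫_ℂ) := by
    have hlim : Tendsto (fun h : ℝ => ⟪y, U w (((h⁻¹ : ℝ) : ℂ) • (T.appReal h (x : H) - x))⟫_ℂ)
        (𝓝[>] 0) (𝓝 ⟪y, U w v⟫_ℂ) :=
      tendsto_const_nhds.inner (((U w).continuous.tendsto _).comp hx)
    refine hlim.congr' ?_
    filter_upwards [self_mem_nhdsWithin, hev] with h (hh : 0 < h) hhr
    rw [slope_def_field, add_sub_cancel_left]
    simp only [hφ]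
    rw [hmul w hw hwr h hh hhr, ContinuousLinearMap.mul_def, ContinuousLinearMap.comp_apply, map_smul,
      map_sub, inner_smul_right, inner_sub_right, ofReal_inv, div_eq_inv_mul]
  have heq : deriv φ w = ⟪y, U w v⟫_ℂ := tendsto_nhds_unique h1 h2
  have := hφd
  rw [heq] at this
  exact this

/-- **Positive energy from a local bounded analytic extension to the upper half-plane.** Let `T` be a
strongly continuous one-parameter unitary group. Suppose that for some `r > 0` there are bounded
operators `U(w)` (`0 ≤ im w`, `|w| < r`) with `U(0) = 1`, `‖U(w)‖ ≤ 1`, all matrix elements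
`w ↦ ⟪x, U(w) y⟫` continuous on the closed half-disc and holomorphic on the open one, and
`U(w + h) = U(w) T(h)` for `im w > 0` and real `h > 0`. Then the Hamiltonian of `T` is positive
(`T.HasPositiveEnergy`). Converse of `exists_upperHalfPlane_extension`; Longo, proof of Thm. 2.4.1
("allows a strongly continuous extension in the upper half plane … norm bounded by 1. Consequently
`U(s) = e^{isP}` for some positive selfadjoint `P`"), proved WITHOUT the spectral theorem.
[cite: Longo2008LecturesConformalNets, Thm. 2.4.1 (proof)] -/
theorem hasPositiveEnergy_of_upperHalfPlane_extension (T : OneParameterUnitaryGroup H) {r : ℝ}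
    (hr : 0 < r) (U : ℂ → H →L[ℂ] H) (hU0 : U 0 = 1)
    (hnorm : ∀ w : ℂ, 0 ≤ w.im → ‖w‖ < r → ‖U w‖ ≤ 1)
    (hcont : ∀ x y : H, ContinuousOn (fun w => ⟪x, U w y⟫_ℂ) {w : ℂ | 0 ≤ w.im ∧ ‖w‖ < r})
    (hdiff : ∀ x y : H, DifferentiableOn ℂ (fun w => ⟪x, U w y⟫_ℂ) {w : ℂ | 0 < w.im ∧ ‖w‖ < r})
    (hmul : ∀ w : ℂ, 0 < w.im → ‖w‖ < r → ∀ h : ℝ, 0 < h → ‖w + h‖ < r →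
      U (w + h) = U w * T.appReal h) :
    T.HasPositiveEnergy := by
  refine ⟨T.hamiltonian_isSymmetric, fun x => ?_⟩
  set v : H := (OneParameterGroup.generator T.toStrongContRepresentation x : H) with hv
  -- `re ⟪x, P x⟫ = im ⟪x, A x⟫`
  have hre : RCLike.re ⟪(x : H), T.hamiltonian x⟫_ℂ = (⟪(x : H), v⟫_ℂ).im := by
    rw [hamiltonian_apply, inner_smul_right]
    simp only [RCLike.re_to_complex, neg_mul, Complex.neg_re, Complex.mul_re, Complex.I_re,
      zero_mul, Complex.I_im, one_mul, zero_sub, neg_neg, hv]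
  rw [hre]
  -- the scalar functions along the imaginary axis
  set φ : ℂ → ℂ := fun w => ⟪(x : H), U w x⟫_ℂ with hφ
  set ψ : ℂ → ℂ := fun w => ⟪(x : H), U w v⟫_ℂ with hψ
  have hφ0 : φ 0 = ((‖(x : H)‖ ^ 2 : ℝ) : ℂ) := by
    simp only [hφ, hU0, one_apply_eq_self, inner_self_eq_norm_sq_to_K]; norm_cast
  have hψ0 : ψ 0 = ⟪(x : H), v⟫_ℂ := by simp only [hψ, hU0, one_apply_eq_self]
  -- Step 1: the derivative of `y ↦ φ(iy)` on `(0, r)` is `ψ(iy) i`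
  have hderiv : ∀ y : ℝ, 0 < y → y < r →
      HasDerivAt (fun y : ℝ => φ (I * y)) (ψ (I * y) * I) y := by
    intro y hy hyr
    have hmem := I_mul_mem_halfDisc hy hyr
    have hφw : HasDerivAt φ (ψ (I * y)) (I * y) :=
      hasDerivAt_inner_extension T U hdiff hmul x (x : H) hmem.1 hmem.2
    have hlin : HasDerivAt (fun z : ℂ => I * z) (I * 1) (y : ℂ) :=
      (hasDerivAt_id _).const_mul I
    have hcomp : HasDerivAt (fun z : ℂ => φ (I * z)) (ψ (I * y) * (I * 1)) (y : ℂ) := by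
      have := hφw.comp (y : ℂ) hlin
      exact this
    rw [mul_one] at hcomp
    exact hcomp.comp_ofReal
  -- continuity of `y ↦ φ(iy)`, `y ↦ ψ(iy) i` on `[0, Y]`, `Y < r`
  have hseg : ∀ Y : ℝ, Y < r → MapsTo (fun y : ℝ => I * (y : ℂ)) (Icc 0 Y)
      {w : ℂ | 0 ≤ w.im ∧ ‖w‖ < r} :=
    fun Y hY y hy => I_mul_mem_closedHalfDisc hy.1 (lt_of_le_of_lt hy.2 hY)
  have hφc : ∀ Y : ℝ, Y < r → ContinuousOn (fun y : ℝ => φ (I * y)) (Icc 0 Y) := fun Y hY =>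
    (hcont (x : H) x).comp (by fun_prop) (hseg Y hY)
  have hψc : ∀ Y : ℝ, Y < r → ContinuousOn (fun y : ℝ => ψ (I * y) * I) (Icc 0 Y) := fun Y hY =>
    ((hcont (x : H) v).comp (by fun_prop) (hseg Y hY)).mul continuousOn_const
  -- Step 2: FTC along `[0, iY]` and the sign of the real part
  have hint : ∀ Y : ℝ, 0 < Y → Y < r →
      (∫ y in (0 : ℝ)..Y, (ψ (I * y) * I).re) ≤ 0 := by
    intro Y hY hYr
    have hFTC := integral_eq_sub_of_hasDerivAt_of_le hY.le (hφc Y hYr)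
      (fun y hy => hderiv y hy.1 (lt_trans hy.2 hYr)) ((hψc Y hYr).intervalIntegrable_of_Icc hY.le)
    -- `re (φ(iY) - φ 0) ≤ 0`
    have hreY : (φ (I * Y)).re ≤ ‖(x : H)‖ ^ 2 := by
      have hmem := I_mul_mem_closedHalfDisc hY.le hYr
      calc (φ (I * Y)).re ≤ ‖φ (I * Y)‖ := re_le_norm _
        _ ≤ ‖(x : H)‖ * ‖U (I * Y) x‖ := norm_inner_le_norm _ _
        _ ≤ ‖(x : H)‖ * (1 * ‖(x : H)‖) := by
            gcongr
            exact ((U _).le_opNorm _).trans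
              (mul_le_mul_of_nonneg_right (hnorm _ hmem.1 hmem.2) (norm_nonneg _))
        _ = ‖(x : H)‖ ^ 2 := by ring
    have hre_int : (∫ y in (0 : ℝ)..Y, (ψ (I * y) * I).re) =
        (∫ y in (0 : ℝ)..Y, ψ (I * y) * I).re := by
      have := (reCLM.intervalIntegral_comp_comm
        ((hψc Y hYr).intervalIntegrable_of_Icc (μ := volume) hY.le))
      simpa only [reCLM_apply] using this
    rw [hre_int, hFTC, sub_re]
    have : (φ (I * ((0 : ℝ) : ℂ))).re = ‖(x : H)‖ ^ 2 := by
      rw [ofReal_zero, mul_zero, hφ0]; norm_cast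
    rw [this]
    linarith
  -- Step 3: if `im ⟪x, Ax⟫ < 0`, the integrand has real part `> c/2 > 0` near `0`: contradiction
  by_contra hneg
  rw [not_le] at hneg
  set c : ℝ := -(⟪(x : H), v⟫_ℂ).im with hc
  have hc0 : 0 < c := by rw [hc]; linarith
  have hk0 : (ψ (I * ((0 : ℝ) : ℂ)) * I).re = c := by
    rw [ofReal_zero, mul_zero, hψ0, mul_re, I_re, I_im, mul_zero, mul_one, zero_sub, hc]
  -- continuity at `0` within `[0, r/2]`
  have hr2 : r / 2 < r := half_lt_self hr
  have hk_cont : ContinuousWithinAt (fun y : ℝ => (ψ (I * y) * I).re) (Icc 0 (r / 2)) 0 :=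
    (continuous_re.comp_continuousOn (hψc (r / 2) hr2)) 0 ⟨le_rfl, (half_pos hr).le⟩
  obtain ⟨δ, hδ, hδk⟩ := Metric.continuousWithinAt_iff.1 hk_cont (c / 2) (half_pos hc0)
  set Y : ℝ := min (δ / 2) (r / 2) with hY
  have hY0 : 0 < Y := lt_min (half_pos hδ) (half_pos hr)
  have hYr : Y < r := (min_le_right _ _).trans_lt hr2
  have hYδ : Y < δ := (min_le_left _ _).trans_lt (half_lt_self hδ)
  have hlow : ∀ y ∈ Icc 0 Y, c / 2 ≤ (ψ (I * y) * I).re := by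
    intro y hy
    have hy' : y ∈ Icc 0 (r / 2) := ⟨hy.1, hy.2.trans (min_le_right _ _)⟩
    have hdist : dist y 0 < δ := by
      rw [dist_zero_right, Real.norm_eq_abs, abs_of_nonneg hy.1]
      exact lt_of_le_of_lt hy.2 hYδ
    have h := hδk hy' hdist
    rw [hk0, Real.dist_eq, abs_sub_lt_iff] at h
    linarith [h.1, h.2]
  have hpos : 0 < ∫ y in (0 : ℝ)..Y, (ψ (I * y) * I).re := by
    have hmono := integral_mono_on hY0.le (intervalIntegrable_const (μ := volume))
      ((continuous_re.comp_continuousOn (hψc Y hYr)).intervalIntegrable_of_Icc hY0.le) hlow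
    have hconst : (∫ _ in (0 : ℝ)..Y, c / 2) = Y * (c / 2) := by
      rw [intervalIntegral.integral_const, sub_zero, smul_eq_mul]
    rw [hconst] at hmono
    exact lt_of_lt_of_le (mul_pos hY0 (half_pos hc0)) hmono
  exact absurd (hint Y hY0 hYr) (not_le.2 hpos)

end UnitaryRep

end Literature.Analysis.UnboundedOperators
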